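import Summits.Ventures.AbcSig.Rows.BridgeC2c
import Summits.Ventures.AbcSig.Rows.C2cL29
import Summits.Ventures.AbcSig.Levels.N7424M4C13K10
import Summits.Ventures.AbcSig.Levels.N7424M4C13K9

/-!
# Venture AbcSig — CELL `C2cL29`: p1's census predicate `Rows.C2cCell 29 {17}` from the C2c row (exponent reduction by `Rows/BridgeC2c.lean`)

K-VARIANT (p-lean g7 `gen7/kpatch.py`): the CITED module-M4 hypotheses for the pairs 7424.9 @ 13, 7424.10 @ 13 (tree orbit indices) are replaced by the KERNEL class-by-class
Kraus discharges of `Levels/N…M4C….lean` (`gen7/m4cgen.py`: class tables = `Recipes/KrausTable.lean` values = the census certificates' `S_q_mod_n`; mod-n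
certificates by `decide +kernel`) under the COMPUTED same-newforms hypotheses `hM_…` and the named hypotheses `hK_…` (`RefinedTraces` per reduced exponent,
CITED recipe [BS04 p. 27 + (3.1), Kra97] + COMPUTED table). Every other hypothesis and the conclusion are those of `Rows/C2cL29Cell.lean` verbatim (cell proof copied; the rows of record are applied unchanged).
HONEST FRAMING. COMPUTATION cell `pub-abcsig`; CONDITIONAL theorem; no claim on ABC or any summit. Hypotheses exactly as in
`Rows/C2cL29.lean`: `BS04Package` (CITED), `DataComplete 7424` / `RefinesCPSymAll 7424` (COMPUTED; norm-form certificates), the row's per-orbit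
CITED exclusions universally quantified in `n` and `m`. Conclusion = the conjunct `Rows.C2cCell 29 {17}` of p1's `C2Part2Signed` /
`C2Part2bSigned` (`Rows/Statements.lean`; row of record `census/rows/C2a/C2c-l29.md`): ALL `m ≥ 1` with `n ∤ m` and all
coprime distributions `A·B = 29^m` — obtained from the reduced rows (`m < n`) by `C2cCell_of_rows` (m ↦ m mod n, y ↦ ℓ^q·y).
-/

namespace Summit.Ventures.AbcSig

/-- Cell `C2cL29`: `Rows.C2cCell 29 {17}` under the row's hypotheses. -/
theorem xcell_C2cL29K (M : NewformModel) (hP : M.BS04Package)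
    (hD7424 : M.DataComplete 7424 level7424Orbits) (hCP7424 : M.RefinesCPSymAll 7424 level7424CP)
    (hM_7424_9 : ∀ f : M.Form 7424, M.Matches f orbit_7424_9 → M.Matches f m4cX_7424_9_n13)
    (hK_7424_9 : ∀ m : ℕ, 1 ≤ m → m < 13 → M.RefinedTraces (famC2c 29 m 13) (m4cTab_a0C2c_7424_9_n13 m))
    (hM_7424_10 : ∀ f : M.Form 7424, M.Matches f orbit_7424_10 → M.Matches f m4cX_7424_10_n13)
    (hK_7424_10 : ∀ m : ℕ, 1 ≤ m → m < 13 → M.RefinedTraces (famC2c 29 m 13) (m4cTab_a0C2c_7424_10_n13 m)) :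
    Rows.C2cCell 29 {17} :=
  C2cCell_of_rows 29 (by norm_num) (by norm_num) _
    (fun n hn h11 hnℓ hR m hm hmn x y z h1 h2 =>
      xrow_C2cL29 M hP hD7424 hCP7424 n hn h11 hnℓ (by intro hmem; simp only [List.mem_cons, List.not_mem_nil, or_false] at hmem; subst hmem; simp at hR) m hm hmn (fun hmem => by
      obtain rfl : n = 13 := by simpa using hmem
      exact orbit_7424_9_exclM4_a0C2c_13 M hM_7424_9 hK_7424_9 m hm hmn) (fun hmem => by
      obtain rfl : n = 13 := by simpa using hmem
      exact orbit_7424_10_exclM4_a0C2c_13 M hM_7424_10 hK_7424_10 m hm hmn) x y z h1 h2)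

end Summit.Ventures.AbcSig
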